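import Summits.CriticalPhenomena.PercolationContinuityZ3.Theorems.PercNearOneGluingNoHeavyLowerTailSeqExchange
import HarnessLib

/-!
# `NoHeavyLowerTail` (stmt-CriticalPhenomena-4575) — the THREE-edge sequential Lemma 3(i)
# ("first-open-edge domination", `k = 3`)

Support file (hull-port / coupling seat `prim-hp-1` gen 10; `--supports stmt-CriticalPhenomena-4575`).
No definitions, no named facts, no sorries.

Setting: `μ = prodBernoulli w` on the bond configurations of `Fin n`, a target vertex `b`; pairs
`e_i = s(v_i,u_i)` (`i = 1,2,3`) with designated endpoints `v_i`, and a vertex `a` with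
`μ(a ↔ b) ≤ μ(v_i ↔ b) + δ_i`.

* `SeqExchange.seq_three` — `μ(a; e₁) + μ(a; ē₁ e₂) + μ(a; ē₁ ē₂ e₃) ≤ μ(v₁; e₁) + μ(v₂; ē₁ e₂) + μ(v₃; ē₁ ē₂ e₃) + max δ₁ (max δ₂ δ₃)`:
  on the event "some `e_i` is open", `a` is dominated by the designated endpoint of the FIRST open pair,
  up to the largest slack.  Proof: Lemma 3(i) for `e₁` (slack `s₁`), then `SeqExchange.seq_two` in the graph
  `w[e₁ ↦ 0]`, whose domination gaps are at most `s₁ + max δ` by the switching lemma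
  (`SeqExchange.switching`); the slack of the first step pays for the gaps (memo HULLPORT-COUPLING.md §50(c)).

Why: with `w` the unglued ranking graph of a depth-two block and `e₁,e₂,e₃` three dangerous port pairs,
the six instances of `seq_three` (one per order) are the covering inequalities
`Σ_σ λ_σ SEQ_σ ≥ 0` of the order-mixture certificates for Kozma–Nitzan's Question 9 with three dangerous
pairs (memo §50 add. 2, §51); `k = 2` is `SeqExchange.seq_two`.
-/

namespace Summit.CriticalPhenomena.PercolationContinuityZ3.Theorems

open MeasureTheory Set
open Literature.Probability.LatticeModels
open Literature.Probability.Percolation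

noncomputable section
open Classical

namespace SeqExchange

variable {n : ℕ}

/-- Closed-side factorisation with one extra event on the right:
`μ(S ∩ {e₁ closed} ∩ T) = (1 − w e₁) · μ_{w[e₁↦0]}(S ∩ T)`. [folklore] -/
theorem real_inter_notMem_inter (w : Sym2 (Fin n) → unitInterval) (e₁ : Sym2 (Fin n))
    (S T : Set (BondConfig (Fin n))) :
    (prodBernoulli w).real (S ∩ {ω | e₁ ∉ ω} ∩ T) =
      (1 - (w e₁ : ℝ)) * (prodBernoulli (Function.update w e₁ 0)).real (S ∩ T) := by
  rw [Set.inter_right_comm]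
  exact goodStepEI_real_inter_closed_eq w e₁ _

/-- Closed-side factorisation with two extra events on the right:
`μ(S ∩ {e₁ closed} ∩ T ∩ U) = (1 − w e₁) · μ_{w[e₁↦0]}(S ∩ T ∩ U)`. [folklore] -/
theorem real_inter_notMem_inter_inter (w : Sym2 (Fin n) → unitInterval) (e₁ : Sym2 (Fin n))
    (S T U : Set (BondConfig (Fin n))) :
    (prodBernoulli w).real (S ∩ {ω | e₁ ∉ ω} ∩ T ∩ U) =
      (1 - (w e₁ : ℝ)) * (prodBernoulli (Function.update w e₁ 0)).real (S ∩ T ∩ U) := by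
  rw [Set.inter_right_comm (S ∩ {ω | e₁ ∉ ω}) T U, Set.inter_right_comm S {ω | e₁ ∉ ω} U,
    Set.inter_right_comm (S ∩ U) {ω | e₁ ∉ ω} T, Set.inter_right_comm S U T]
  exact goodStepEI_real_inter_closed_eq w e₁ _

/-- The domination gap after deleting `e₁ = s(v₁,u₁)` is paid by the slack of Lemma 3(i) for `e₁`:
`(1 − w e₁)·(μ₀(a ↔ b) − μ₀(v ↔ b)) ≤ [μ(v₁; e₁) − μ(a; e₁)] + max δ₁ δ` for `μ₀ = μ_{w[e₁↦0]}`, whenever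
`μ(a) ≤ μ(v₁) + δ₁` and `μ(a) ≤ μ(v) + δ` (a restatement of `switching`).
[cite: KozmaNitzan2024, Lemma 5 (p. 13); this work (memo HULLPORT-COUPLING.md §50(b))] -/
theorem gap_after_delete (w : Sym2 (Fin n) → unitInterval) (a v₁ u₁ v b : Fin n) (h₁ne : v₁ ≠ u₁)
    {δ₁ δ : ℝ}
    (h₁ : (prodBernoulli w).real (openConn a b) ≤ (prodBernoulli w).real (openConn v₁ b) + δ₁)
    (h : (prodBernoulli w).real (openConn a b) ≤ (prodBernoulli w).real (openConn v b) + δ) :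
    (1 - (w s(v₁, u₁) : ℝ)) *
        ((prodBernoulli (Function.update w s(v₁, u₁) 0)).real (openConn a b) -
          (prodBernoulli (Function.update w s(v₁, u₁) 0)).real (openConn v b)) ≤
      ((prodBernoulli w).real (openConn v₁ b ∩ {ω | s(v₁, u₁) ∈ ω}) -
          (prodBernoulli w).real (openConn a b ∩ {ω | s(v₁, u₁) ∈ ω})) + max δ₁ δ := by
  set e₁ : Sym2 (Fin n) := s(v₁, u₁) with he₁
  have hsw := switching w a v₁ u₁ v b h₁ne h₁ h
  have hsplit := real_eq_inter_mem_add_inter_notMem w e₁ (openConn a b)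
  have hcl_a : (prodBernoulli w).real (openConn a b ∩ {ω | e₁ ∉ ω}) =
      (1 - (w e₁ : ℝ)) * (prodBernoulli (Function.update w e₁ 0)).real (openConn a b) :=
    goodStepEI_real_inter_closed_eq w e₁ _
  have hcl_v : (prodBernoulli w).real (openConn v b ∩ {ω | e₁ ∉ ω}) =
      (1 - (w e₁ : ℝ)) * (prodBernoulli (Function.update w e₁ 0)).real (openConn v b) :=
    goodStepEI_real_inter_closed_eq w e₁ _
  have : (prodBernoulli w).real (openConn a b ∩ {ω | e₁ ∉ ω}) -
      (prodBernoulli w).real (openConn v b ∩ {ω | e₁ ∉ ω}) ≤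
      ((prodBernoulli w).real (openConn v₁ b ∩ {ω | e₁ ∈ ω}) -
        (prodBernoulli w).real (openConn a b ∩ {ω | e₁ ∈ ω})) + max δ₁ δ := by
    linarith
  rw [hcl_a, hcl_v] at this
  linarith

/-- **Three-edge sequential Lemma 3(i) ("first-open-edge domination", `k = 3`).**  Non-loop pairs
`e_i = s(v_i,u_i)` (`i = 1,2,3`); a vertex `a` with `μ(a ↔ b) ≤ μ(v_i ↔ b) + δ_i` (`δ₁ ≥ 0`).  Then
`μ(a; e₁) + μ(a; ē₁ ∩ e₂) + μ(a; ē₁ ∩ ē₂ ∩ e₃) ≤ μ(v₁; e₁) + μ(v₂; ē₁ ∩ e₂) + μ(v₃; ē₁ ∩ ē₂ ∩ e₃) + max δ₁ (max δ₂ δ₃)`: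
on "some `e_i` open", `a` is dominated by the endpoint of the first open pair.
[cite: KozmaNitzan2024, Lemma 3(i) (pp. 6–7), Lemma 5 (p. 13); this work (memo HULLPORT-COUPLING.md §50(c), §51)] -/
theorem seq_three (w : Sym2 (Fin n) → unitInterval) (a v₁ u₁ v₂ u₂ v₃ u₃ b : Fin n) (h₁ne : v₁ ≠ u₁)
    (h₂ne : v₂ ≠ u₂) (h₃ne : v₃ ≠ u₃) {δ₁ δ₂ δ₃ : ℝ} (hδ₁ : 0 ≤ δ₁)
    (h₁ : (prodBernoulli w).real (openConn a b) ≤ (prodBernoulli w).real (openConn v₁ b) + δ₁)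
    (h₂ : (prodBernoulli w).real (openConn a b) ≤ (prodBernoulli w).real (openConn v₂ b) + δ₂)
    (h₃ : (prodBernoulli w).real (openConn a b) ≤ (prodBernoulli w).real (openConn v₃ b) + δ₃) :
    (prodBernoulli w).real (openConn a b ∩ {ω | s(v₁, u₁) ∈ ω}) +
        (prodBernoulli w).real (openConn a b ∩ {ω | s(v₁, u₁) ∉ ω} ∩ {ω | s(v₂, u₂) ∈ ω}) +
          (prodBernoulli w).real
            (openConn a b ∩ {ω | s(v₁, u₁) ∉ ω} ∩ {ω | s(v₂, u₂) ∉ ω} ∩ {ω | s(v₃, u₃) ∈ ω}) ≤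
      (prodBernoulli w).real (openConn v₁ b ∩ {ω | s(v₁, u₁) ∈ ω}) +
        (prodBernoulli w).real (openConn v₂ b ∩ {ω | s(v₁, u₁) ∉ ω} ∩ {ω | s(v₂, u₂) ∈ ω}) +
          (prodBernoulli w).real
            (openConn v₃ b ∩ {ω | s(v₁, u₁) ∉ ω} ∩ {ω | s(v₂, u₂) ∉ ω} ∩ {ω | s(v₃, u₃) ∈ ω}) +
        max δ₁ (max δ₂ δ₃) := by
  set μ := prodBernoulli w with hμ
  set e₁ : Sym2 (Fin n) := s(v₁, u₁) with he₁
  set e₂ : Sym2 (Fin n) := s(v₂, u₂) with he₂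
  set e₃ : Sym2 (Fin n) := s(v₃, u₃) with he₃
  set w₀ : Sym2 (Fin n) → unitInterval := Function.update w e₁ 0 with hw₀
  set μ₀ := prodBernoulli w₀ with hμ₀
  set M : ℝ := max δ₁ (max δ₂ δ₃) with hM
  have hm₁ : δ₁ ≤ M := le_max_left _ _
  have hm₂ : δ₂ ≤ M := (le_max_left _ _).trans (le_max_right _ _)
  have hm₃ : δ₃ ≤ M := (le_max_right _ _).trans (le_max_right _ _)
  have hM0 : 0 ≤ M := hδ₁.trans hm₁
  have hρ0 : 0 ≤ (w e₁ : ℝ) := (w e₁).2.1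
  have hρ1 : (w e₁ : ℝ) ≤ 1 := (w e₁).2.2
  -- step 1: Lemma 3(i) for `e₁`, slack `s₁ ≥ -δ₁ ρ₁`
  have step1 := lemma3i_pair w a v₁ u₁ b h₁ne hδ₁ h₁
  rw [real_setOf_mem] at step1
  set s₁ : ℝ := μ.real (openConn v₁ b ∩ {ω | e₁ ∈ ω}) - μ.real (openConn a b ∩ {ω | e₁ ∈ ω}) with hs₁
  have hs₁lb : -(δ₁ * (w e₁ : ℝ)) ≤ s₁ := by rw [hs₁]; linarith
  have hsM : 0 ≤ s₁ + M := by
    have : 0 ≤ δ₁ * (w e₁ : ℝ) := mul_nonneg hδ₁ hρ0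
    have : δ₁ * (w e₁ : ℝ) ≤ δ₁ := by nlinarith
    linarith
  -- the gaps in `w₀` for `v₂` and `v₃`
  have hgap₂ : (1 - (w e₁ : ℝ)) * (μ₀.real (openConn a b) - μ₀.real (openConn v₂ b)) ≤ s₁ + M := by
    have := gap_after_delete w a v₁ u₁ v₂ b h₁ne h₁ h₂
    have hmm : max δ₁ δ₂ ≤ M := max_le hm₁ hm₂
    rw [hs₁]; linarith
  have hgap₃ : (1 - (w e₁ : ℝ)) * (μ₀.real (openConn a b) - μ₀.real (openConn v₃ b)) ≤ s₁ + M := by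
    have := gap_after_delete w a v₁ u₁ v₃ b h₁ne h₁ h₃
    have hmm : max δ₁ δ₃ ≤ M := max_le hm₁ hm₃
    rw [hs₁]; linarith
  -- slacks in `w₀`
  set δ₂' : ℝ := max 0 (μ₀.real (openConn a b) - μ₀.real (openConn v₂ b)) with hδ₂'
  set δ₃' : ℝ := max 0 (μ₀.real (openConn a b) - μ₀.real (openConn v₃ b)) with hδ₃'
  have hδ₂'0 : 0 ≤ δ₂' := le_max_left _ _
  have hδ₂'h : μ₀.real (openConn a b) ≤ μ₀.real (openConn v₂ b) + δ₂' := by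
    have := le_max_right 0 (μ₀.real (openConn a b) - μ₀.real (openConn v₂ b))
    rw [← hδ₂'] at this; linarith
  have hδ₃'h : μ₀.real (openConn a b) ≤ μ₀.real (openConn v₃ b) + δ₃' := by
    have := le_max_right 0 (μ₀.real (openConn a b) - μ₀.real (openConn v₃ b))
    rw [← hδ₃'] at this; linarith
  have hmax' : (1 - (w e₁ : ℝ)) * max δ₂' δ₃' ≤ s₁ + M := by
    have h2 : (1 - (w e₁ : ℝ)) * δ₂' ≤ s₁ + M := by
      rcases le_total 0 (μ₀.real (openConn a b) - μ₀.real (openConn v₂ b)) with hpos | hneg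
      · rw [hδ₂', max_eq_right hpos]; exact hgap₂
      · rw [hδ₂', max_eq_left hneg, mul_zero]; exact hsM
    have h3 : (1 - (w e₁ : ℝ)) * δ₃' ≤ s₁ + M := by
      rcases le_total 0 (μ₀.real (openConn a b) - μ₀.real (openConn v₃ b)) with hpos | hneg
      · rw [hδ₃', max_eq_right hpos]; exact hgap₃
      · rw [hδ₃', max_eq_left hneg, mul_zero]; exact hsM
    rcases le_total δ₂' δ₃' with h23 | h32
    · rw [max_eq_right h23]; exact h3
    · rw [max_eq_left h32]; exact h2
  -- step 2: the two-edge lemma in `w₀`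
  have step2 := seq_two w₀ a v₂ u₂ v₃ u₃ b h₂ne h₃ne hδ₂'0 hδ₂'h hδ₃'h
  -- closed-side factorisations along `e₁`
  have hA2 : μ.real (openConn a b ∩ {ω | e₁ ∉ ω} ∩ {ω | e₂ ∈ ω}) =
      (1 - (w e₁ : ℝ)) * μ₀.real (openConn a b ∩ {ω | e₂ ∈ ω}) := real_inter_notMem_inter w e₁ _ _
  have hV2 : μ.real (openConn v₂ b ∩ {ω | e₁ ∉ ω} ∩ {ω | e₂ ∈ ω}) =
      (1 - (w e₁ : ℝ)) * μ₀.real (openConn v₂ b ∩ {ω | e₂ ∈ ω}) := real_inter_notMem_inter w e₁ _ _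
  have hA3 : μ.real (openConn a b ∩ {ω | e₁ ∉ ω} ∩ {ω | e₂ ∉ ω} ∩ {ω | e₃ ∈ ω}) =
      (1 - (w e₁ : ℝ)) * μ₀.real (openConn a b ∩ {ω | e₂ ∉ ω} ∩ {ω | e₃ ∈ ω}) :=
    real_inter_notMem_inter_inter w e₁ _ _ _
  have hV3 : μ.real (openConn v₃ b ∩ {ω | e₁ ∉ ω} ∩ {ω | e₂ ∉ ω} ∩ {ω | e₃ ∈ ω}) =
      (1 - (w e₁ : ℝ)) * μ₀.real (openConn v₃ b ∩ {ω | e₂ ∉ ω} ∩ {ω | e₃ ∈ ω}) :=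
    real_inter_notMem_inter_inter w e₁ _ _ _
  -- assemble: the `w₀` part
  have hmain : μ.real (openConn a b ∩ {ω | e₁ ∉ ω} ∩ {ω | e₂ ∈ ω}) +
      μ.real (openConn a b ∩ {ω | e₁ ∉ ω} ∩ {ω | e₂ ∉ ω} ∩ {ω | e₃ ∈ ω}) ≤
      μ.real (openConn v₂ b ∩ {ω | e₁ ∉ ω} ∩ {ω | e₂ ∈ ω}) +
        μ.real (openConn v₃ b ∩ {ω | e₁ ∉ ω} ∩ {ω | e₂ ∉ ω} ∩ {ω | e₃ ∈ ω}) + (s₁ + M) := by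
    rw [hA2, hV2, hA3, hV3]
    have h1' : (1 - (w e₁ : ℝ)) * (μ₀.real (openConn a b ∩ {ω | e₂ ∈ ω}) +
        μ₀.real (openConn a b ∩ {ω | e₂ ∉ ω} ∩ {ω | e₃ ∈ ω})) ≤
        (1 - (w e₁ : ℝ)) * (μ₀.real (openConn v₂ b ∩ {ω | e₂ ∈ ω}) +
          μ₀.real (openConn v₃ b ∩ {ω | e₂ ∉ ω} ∩ {ω | e₃ ∈ ω}) + max δ₂' δ₃') :=
      mul_le_mul_of_nonneg_left step2 (by linarith)
    nlinarith [h1', hmax']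
  -- the first term: `μ(a; e₁) = μ(v₁; e₁) - s₁`
  have hfirst : μ.real (openConn a b ∩ {ω | e₁ ∈ ω}) = μ.real (openConn v₁ b ∩ {ω | e₁ ∈ ω}) - s₁ := by
    rw [hs₁]; ring
  linarith [hmain, hfirst]

end SeqExchange

end

end Summit.CriticalPhenomena.PercolationContinuityZ3.Theorems
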